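import Literature.NumberTheory.ModularForms.LevelOneEisensteinCongruenceCuspForm
import Literature.NumberTheory.ModularForms.LevelOneCuspFormsRankOne
import Literature.NumberTheory.ModularForms.LevelOneWeightTwentyFourEigenforms
import Literature.NumberTheory.LFunctions.Hinkkanen1997.BernoulliTable
import HarnessLib

/-!
# Ramanujan's and Manin's congruences: `f_k ≡ G_k mod N_k` in the one-dimensional weights `k = 12, 16, 18, 20, 22, 26`
# (Datskovsky–Guerzhoy, Cor. 1.1)

B. Datskovsky, P. Guerzhoy, *On Ramanujan congruences for modular forms of integral and half-integral weights*,
Proc. Amer. Math. Soc. **124** (1996), p. 2285, verbatim: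

> "**Corollary 1.1.** Suppose `dim S_k = 1`. Let `f_k` denote the unique cusp form of weight `k` normalized so that its
> first Fourier coefficient is `1`. Then `f_k ≡ G_k mod N_k`. …
> When `k = 12`, Corollary 1.1 yields the Ramanujan congruence modulo `691`. For `k = 16, 18, 20, 22`, and `26`, it
> implies the following congruences, first obtained by Manin [9]:
> `σ₁₅(n) ≡ τ(n) + 240 Σ_{m=1}^{n−1} σ₃(m)τ(n−m) mod 3617`;
> `σ₁₇(n) ≡ τ(n) − 504 Σ σ₅(m)τ(n−m) mod 43867`;
> `σ₁₉(n) ≡ τ(n) + 480 Σ σ₇(m)τ(n−m) mod 283·617`;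
> `σ₂₁(n) ≡ τ(n) − 264 Σ σ₉(m)τ(n−m) mod 131·593`;
> `σ₂₅(n) ≡ τ(n) − 24 Σ σ₁₃(m)τ(n−m) mod 657931`."

(The right-hand sides are the coefficients of the normalized cusp forms `f₁₆ = ΔE₄`, `f₁₈ = ΔE₆`, `f₂₀ = ΔE₈`,
`f₂₂ = ΔE₁₀`, `f₂₆ = ΔE₁₄`; `N_k` is the numerator of `B_k/2k`.)

This file PROVES, from the tree's Corollary 1.1 (`IsNormalizedCuspEigenform.congr_eisensteinG_of_finrank_eq_one`, file
`LevelOneEisensteinCongruenceCuspForm`), the level-one dimensions `dim S_k = 1` for `k ∈ {12, 16, 18, 20, 22, 26}`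
(`CuspForm.finrank_eq_one_of_weight_mem`) and the Bernoulli numbers `B₁₂, …, B₂₆` (`Hinkkanen1997.BernoulliTable`):
the values `N₁₂ = 691`, `N₁₆ = 3617`, `N₁₈ = 43867`, `N₂₀ = 174611 = 283·617`, `N₂₂ = 77683 = 131·593`,
`N₂₆ = 657931`; the existence and uniqueness of the normalized eigenform `f_k` in these weights; and
**`a_n(f_k) ≡ σ_{k−1}(n) (mod N_k)` for all `n ≥ 1`** in each of the six weights. For `k = 12` we also identify
`f₁₂ = Δ` (Mathlib's `CuspForm.discriminant` is a normalized eigenform), so that the `k = 12` case is Ramanujan's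
`τ(n) ≡ σ₁₁(n) (mod 691)` — which the tree also proves independently from even unimodular lattices of rank `24`
(`RamanujanCongruence691.ramanujanTau_congr_sigma_eleven`); the convolution right-hand sides printed by DG are the
`q`-expansion coefficients of `ΔE_{k−12}` and are not expanded here.

## References

* [DatskovskyGuerzhoy1996] B. Datskovsky, P. Guerzhoy, Proc. AMS 124 (1996), Cor. 1.1 and the list of Manin's
  congruences (p. 2285).
* [Manin1973] Ju. I. Manin, *Periods of parabolic forms and p-adic Hecke series*, Math. USSR Sb. 21 (1973) (the
  congruences for `k = 16, …, 26`, cited by DG as [9]).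
* [Serre1973] J.-P. Serre, *A Course in Arithmetic*, GTM 7, Ch. VII §4.5 (57), §5.5 Remark (the one-dimensional `S_k`).
-/

noncomputable section

open scoped MatrixGroups ModularForm
open UpperHalfPlane hiding I
open ArithmeticFunction (sigma sigma_one)

namespace Literature.NumberTheory.ModularForms

/-! ## §1 The numerators `N_k` for `k = 12, 16, 18, 20, 22, 26` -/

section Numerators

open Literature.NumberTheory.LFunctions.Hinkkanen1997

/-- `N_k` from an explicit reduced fraction `B_k/2k = a/b`. [cite: DatskovskyGuerzhoy1996, §1 (definition of `N_k`)] -/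
theorem eisensteinNumerator_eq_of_bernoulliRatio_eq {k : ℕ} {a : ℤ} {b : ℕ} (hb : 0 < b) (hab : a.natAbs.Coprime b)
    (h : bernoulliRatio k = (a : ℚ) / (b : ℚ)) : eisensteinNumerator k = a.natAbs := by
  rw [eisensteinNumerator, h, show ((b : ℕ) : ℚ) = ((b : ℤ) : ℚ) by norm_num,
    Rat.num_div_eq_of_coprime (by exact_mod_cast hb) (by simpa using hab)]

/-- ★ **`N₁₂ = 691`** (`B₁₂/24 = −691/65520`). [cite: DatskovskyGuerzhoy1996, Cor. 1.1 ("the Ramanujan congruence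
modulo `691`")] -/
theorem eisensteinNumerator_twelve : eisensteinNumerator 12 = 691 :=
  eisensteinNumerator_eq_of_bernoulliRatio_eq (a := -691) (b := 65520) (by norm_num) (by decide) (by
    rw [bernoulliRatio, bernoulli_eq_bernoulli'_of_ne_one (by norm_num), bernoulli'_12]; norm_num)

/-- ★ **`N₁₆ = 3617`** (`B₁₆/32 = −3617/16320`). [cite: DatskovskyGuerzhoy1996, Cor. 1.1 (list, `mod 3617`)] -/
theorem eisensteinNumerator_sixteen : eisensteinNumerator 16 = 3617 :=
  eisensteinNumerator_eq_of_bernoulliRatio_eq (a := -3617) (b := 16320) (by norm_num) (by decide) (by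
    rw [bernoulliRatio, bernoulli_eq_bernoulli'_of_ne_one (by norm_num), bernoulli'_16]; norm_num)

/-- ★ **`N₁₈ = 43867`** (`B₁₈/36 = 43867/28728`). [cite: DatskovskyGuerzhoy1996, Cor. 1.1 (list, `mod 43867`)] -/
theorem eisensteinNumerator_eighteen : eisensteinNumerator 18 = 43867 :=
  eisensteinNumerator_eq_of_bernoulliRatio_eq (a := 43867) (b := 28728) (by norm_num) (by decide) (by
    rw [bernoulliRatio, bernoulli_eq_bernoulli'_of_ne_one (by norm_num), bernoulli'_18]; norm_num)

/-- ★ **`N₂₀ = 174611 = 283 · 617`** (`B₂₀/40 = −174611/13200`). [cite: DatskovskyGuerzhoy1996, Cor. 1.1 (list,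
`mod 283·617`)] -/
theorem eisensteinNumerator_twenty : eisensteinNumerator 20 = 174611 ∧ (174611 : ℕ) = 283 * 617 :=
  ⟨eisensteinNumerator_eq_of_bernoulliRatio_eq (a := -174611) (b := 13200) (by norm_num) (by decide) (by
    rw [bernoulliRatio, bernoulli_eq_bernoulli'_of_ne_one (by norm_num), bernoulli'_20]; norm_num), by norm_num⟩

/-- ★ **`N₂₂ = 77683 = 131 · 593`** (`B₂₂/44 = 854513/6072 = 77683/552`). [cite: DatskovskyGuerzhoy1996, Cor. 1.1
(list, `mod 131·593`)] -/
theorem eisensteinNumerator_twentyTwo : eisensteinNumerator 22 = 77683 ∧ (77683 : ℕ) = 131 * 593 :=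
  ⟨eisensteinNumerator_eq_of_bernoulliRatio_eq (a := 77683) (b := 552) (by norm_num) (by decide) (by
    rw [bernoulliRatio, bernoulli_eq_bernoulli'_of_ne_one (by norm_num), bernoulli'_22]; norm_num), by norm_num⟩

/-- ★ **`N₂₆ = 657931`** (`B₂₆/52 = 8553103/312 = 657931/24`). [cite: DatskovskyGuerzhoy1996, Cor. 1.1 (list,
`mod 657931`)] -/
theorem eisensteinNumerator_twentySix : eisensteinNumerator 26 = 657931 :=
  eisensteinNumerator_eq_of_bernoulliRatio_eq (a := 657931) (b := 24) (by norm_num) (by decide) (by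
    rw [bernoulliRatio, bernoulli_eq_bernoulli'_of_ne_one (by norm_num), bernoulli'_26]; norm_num)

end Numerators

/-! ## §2 The normalized eigenform `f_k` in a one-dimensional weight -/

section RankOne

/-- **In weights `12, 16, 18, 20, 22, 26` there is exactly one normalized eigenform `f_k`** ("the unique cusp form of
weight `k` normalized so that its first Fourier coefficient is `1`"; there are `dim S_k = 1` of them).
[cite: DatskovskyGuerzhoy1996, Cor. 1.1] [cite: Serre1973, Ch. VII §5.5 Remark] -/
theorem existsUnique_isNormalizedCuspEigenform_of_weight_mem {k : ℤ}
    (hk : k = 12 ∨ k = 16 ∨ k = 18 ∨ k = 20 ∨ k = 22 ∨ k = 26) :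
    ∃! f : CuspForm 𝒮ℒ k, IsNormalizedCuspEigenform f := by
  have h := ncard_setOf_isNormalizedCuspEigenform k
  rw [CuspForm.finrank_eq_one_of_weight_mem hk, Set.ncard_eq_one] at h
  obtain ⟨f, hf⟩ := h
  refine ⟨f, ?_, fun g hg => ?_⟩
  · have : f ∈ ({f} : Set (CuspForm 𝒮ℒ k)) := Set.mem_singleton f
    rw [← hf] at this
    exact this
  · have : g ∈ {f : CuspForm 𝒮ℒ k | IsNormalizedCuspEigenform f} := hg
    rw [hf] at this
    exact this

/-- ★ **Datskovsky–Guerzhoy Cor. 1.1 in the six one-dimensional weights**: for `k ∈ {12, 16, 18, 20, 22, 26}` and the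
normalized eigenform `f_k`, every coefficient `a_n(f_k)` (`n ≥ 1`) is an integer with `a_n(f_k) ≡ σ_{k−1}(n) (mod N_k)`.
[cite: DatskovskyGuerzhoy1996, Cor. 1.1] -/
theorem IsNormalizedCuspEigenform.congr_sigma_of_weight_mem {k : ℕ}
    (hk : k = 12 ∨ k = 16 ∨ k = 18 ∨ k = 20 ∨ k = 22 ∨ k = 26) {f : CuspForm 𝒮ℒ (k : ℤ)}
    (hf : IsNormalizedCuspEigenform f) {n : ℕ} (hn : 0 < n) :
    ∃ a : ℤ, (a : ℂ) = (qExpansion 1 ⇑f).coeff n ∧ ((eisensteinNumerator k : ℕ) : ℤ) ∣ a - sigma (k - 1) n := by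
  have hk3 : 3 ≤ k := by omega
  have hk2 : Even k := by rcases hk with rfl | rfl | rfl | rfl | rfl | rfl <;> decide
  have hkZ : (k : ℤ) = 12 ∨ (k : ℤ) = 16 ∨ (k : ℤ) = 18 ∨ (k : ℤ) = 20 ∨ (k : ℤ) = 22 ∨ (k : ℤ) = 26 := by omega
  exact hf.congr_eisensteinG_of_finrank_eq_one hk3 hk2 (CuspForm.finrank_eq_one_of_weight_mem hkZ) hn

end RankOne

/-! ## §3 The six congruences -/

section Congruences

/-- ★ **`k = 12`: `a_n(f₁₂) ≡ σ₁₁(n) (mod 691)`** — Ramanujan's congruence (`f₁₂ = Δ`, `a_n = τ(n)`, see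
`isNormalizedCuspEigenform_discriminant`; the tree's `ramanujanTau_congr_sigma_eleven` proves it independently).
[cite: DatskovskyGuerzhoy1996, Cor. 1.1 ("yields the Ramanujan congruence modulo `691`")] [cite: Serre1973, Ch. VII
§4.5 (57)] -/
theorem IsNormalizedCuspEigenform.congr_sigma_eleven {f : CuspForm 𝒮ℒ 12} (hf : IsNormalizedCuspEigenform f)
    {n : ℕ} (hn : 0 < n) : ∃ a : ℤ, (a : ℂ) = (qExpansion 1 ⇑f).coeff n ∧ (691 : ℤ) ∣ a - sigma 11 n := by
  have h := IsNormalizedCuspEigenform.congr_sigma_of_weight_mem (k := 12) (Or.inl rfl) hf hn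
  rwa [eisensteinNumerator_twelve] at h

/-- ★ **`k = 16` (Manin): `a_n(f₁₆) ≡ σ₁₅(n) (mod 3617)`** (`f₁₆ = ΔE₄`: "`σ₁₅(n) ≡ τ(n) + 240Σσ₃(m)τ(n−m) mod 3617`").
[cite: DatskovskyGuerzhoy1996, Cor. 1.1 (list)] -/
theorem IsNormalizedCuspEigenform.congr_sigma_fifteen {f : CuspForm 𝒮ℒ 16} (hf : IsNormalizedCuspEigenform f)
    {n : ℕ} (hn : 0 < n) : ∃ a : ℤ, (a : ℂ) = (qExpansion 1 ⇑f).coeff n ∧ (3617 : ℤ) ∣ a - sigma 15 n := by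
  have h := IsNormalizedCuspEigenform.congr_sigma_of_weight_mem (k := 16) (Or.inr (Or.inl rfl)) hf hn
  rwa [eisensteinNumerator_sixteen] at h

/-- ★ **`k = 18` (Manin): `a_n(f₁₈) ≡ σ₁₇(n) (mod 43867)`** (`f₁₈ = ΔE₆`). [cite: DatskovskyGuerzhoy1996, Cor. 1.1 (list)] -/
theorem IsNormalizedCuspEigenform.congr_sigma_seventeen {f : CuspForm 𝒮ℒ 18} (hf : IsNormalizedCuspEigenform f)
    {n : ℕ} (hn : 0 < n) : ∃ a : ℤ, (a : ℂ) = (qExpansion 1 ⇑f).coeff n ∧ (43867 : ℤ) ∣ a - sigma 17 n := by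
  have h := IsNormalizedCuspEigenform.congr_sigma_of_weight_mem (k := 18) (Or.inr (Or.inr (Or.inl rfl))) hf hn
  rwa [eisensteinNumerator_eighteen] at h

/-- ★ **`k = 20` (Manin): `a_n(f₂₀) ≡ σ₁₉(n) (mod 283·617)`** (`f₂₀ = ΔE₈`). [cite: DatskovskyGuerzhoy1996, Cor. 1.1 (list)] -/
theorem IsNormalizedCuspEigenform.congr_sigma_nineteen {f : CuspForm 𝒮ℒ 20} (hf : IsNormalizedCuspEigenform f)
    {n : ℕ} (hn : 0 < n) : ∃ a : ℤ, (a : ℂ) = (qExpansion 1 ⇑f).coeff n ∧ (283 * 617 : ℤ) ∣ a - sigma 19 n := by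
  have h := IsNormalizedCuspEigenform.congr_sigma_of_weight_mem (k := 20) (Or.inr (Or.inr (Or.inr (Or.inl rfl)))) hf hn
  rwa [eisensteinNumerator_twenty.1] at h

/-- ★ **`k = 22` (Manin): `a_n(f₂₂) ≡ σ₂₁(n) (mod 131·593)`** (`f₂₂ = ΔE₁₀`). [cite: DatskovskyGuerzhoy1996, Cor. 1.1 (list)] -/
theorem IsNormalizedCuspEigenform.congr_sigma_twentyOne {f : CuspForm 𝒮ℒ 22} (hf : IsNormalizedCuspEigenform f)
    {n : ℕ} (hn : 0 < n) : ∃ a : ℤ, (a : ℂ) = (qExpansion 1 ⇑f).coeff n ∧ (131 * 593 : ℤ) ∣ a - sigma 21 n := by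
  have h := IsNormalizedCuspEigenform.congr_sigma_of_weight_mem (k := 22)
    (Or.inr (Or.inr (Or.inr (Or.inr (Or.inl rfl))))) hf hn
  rwa [eisensteinNumerator_twentyTwo.1] at h

/-- ★ **`k = 26` (Manin): `a_n(f₂₆) ≡ σ₂₅(n) (mod 657931)`** (`f₂₆ = ΔE₁₄`). [cite: DatskovskyGuerzhoy1996, Cor. 1.1 (list)] -/
theorem IsNormalizedCuspEigenform.congr_sigma_twentyFive {f : CuspForm 𝒮ℒ 26} (hf : IsNormalizedCuspEigenform f)
    {n : ℕ} (hn : 0 < n) : ∃ a : ℤ, (a : ℂ) = (qExpansion 1 ⇑f).coeff n ∧ (657931 : ℤ) ∣ a - sigma 25 n := by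
  have h := IsNormalizedCuspEigenform.congr_sigma_of_weight_mem (k := 26)
    (Or.inr (Or.inr (Or.inr (Or.inr (Or.inr rfl))))) hf hn
  rwa [eisensteinNumerator_twentySix] at h

end Congruences

/-! ## §4 `f₁₂ = Δ` -/

section Delta

/-- ★ **`Δ` is the normalized eigenform of weight `12`**: Mathlib's `CuspForm.discriminant` is a simultaneous Hecke
eigenform (`dim S₁₂ = 1`) with `a₁(Δ) = τ(1) = 1`. [cite: Serre1973, Ch. VII §4.5, §5.5 Remark ("`M⁰_k` … has
dimension `1`; this happens for `k = 6` … with basis `Δ`")] [cite: DatskovskyGuerzhoy1996, §1 ("the unique normalized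
cusp form `Δ` of weight `12`")] -/
theorem isNormalizedCuspEigenform_discriminant : IsNormalizedCuspEigenform CuspForm.discriminant := by
  rw [isNormalizedCuspEigenform_iff]
  refine ⟨fun n hn => exists_heckeTCusp_eq_smul_of_weight_mem (Or.inl rfl) hn _, ?_⟩
  rw [CuspForm.coe_discriminant, ← WeightTwentyFour.coeff_deltaUnit_eq 0]
  exact WeightTwentyFour.coeff_deltaUnit.1

/-- The normalized eigenform of weight `12` is `Δ`. [cite: DatskovskyGuerzhoy1996, §1 and Cor. 1.1] -/
theorem eq_discriminant_of_isNormalizedCuspEigenform {f : CuspForm 𝒮ℒ 12} (hf : IsNormalizedCuspEigenform f) :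
    f = CuspForm.discriminant :=
  (existsUnique_isNormalizedCuspEigenform_of_weight_mem (Or.inl rfl)).unique hf isNormalizedCuspEigenform_discriminant

/-- ★ **Ramanujan's congruence from Cor. 1.1**: the `n`-th `q`-expansion coefficient of `Δ` (`= τ(n)`) is an integer
`≡ σ₁₁(n) (mod 691)`, `n ≥ 1`. [cite: DatskovskyGuerzhoy1996, Cor. 1.1 ("When `k = 12`, Corollary 1.1 yields the Ramanujan
congruence modulo `691`")] [cite: Serre1973, Ch. VII §4.5 (57)] -/
theorem discriminant_coeff_congr_sigma_eleven {n : ℕ} (hn : 0 < n) :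
    ∃ a : ℤ, (a : ℂ) = (qExpansion 1 ModularForm.discriminant).coeff n ∧ (691 : ℤ) ∣ a - sigma 11 n := by
  have h := isNormalizedCuspEigenform_discriminant.congr_sigma_eleven hn
  rwa [CuspForm.coe_discriminant] at h

end Delta

end Literature.NumberTheory.ModularForms
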